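import Summits.ResolutionOfSingularities.ResolutionOfSingularities.Theorems.MaxContactCutFactorCut
import Summits.ResolutionOfSingularities.ResolutionOfSingularities.Theorems.RestrictCutCells
import HarnessLib

/-!
# MaxContactCutRestrictCut — decomp-res node «RestrictCut» (lens-4 g34, critic row 194 CLEARED (NP-R) DECIDED +1 ·
MAP 0), tree file 4/4 of the node

Content VERBATIM from the decomp-res lens-4 g34 node `HOME/decomp-res-lens-4/g34/RestrictCut.lean` (pin bc9b1075; no
carry, imports the landed tree only); HOME = run/shared/lean/pub/decomp-res; critic row 194 CLEARED (NP-R) DECIDED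
+1 · MAP 0; landing orders INBOX :1128/:1135 — provenance, critic text and the lens header in full in the first file
of the node, `RestrictCutKernels`.  Namespace `…Theorems.HugValuationCut`; `--supports stmt-ResolutionOfSingularities-28338`.

## This file

§110 (g34 · NEW) THE RE-LOCATIONS MODULO 31571 AND THE SURFACE PORT, in the Theses cone (`section
NonDivisorialThesesCone`): `noWildMixedWallFreeFreshJumpShallowCompanionKangarooTowers_iff_g34_of_h71` ·
`noWildNonSurfaceWallFreeFreshJumpShallowCompanionKangarooTowers_iff_g34_of_h71` ·
`noWildContactFreeOffLocusTowers_iff_g34` · `noWildPPowerOffLocusTowers_iff_g34` ·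
`noWildKangarooOffLocusTowers_iff_g34` · `noWildKangarooOffDoublePointTowers_iff_g34` — given 31571
`MaxContactCut.NoContactHuggingTowers` BY NAME (and the port `SurfaceChainPort` = CJS2020 Thm 6.40 where stated):
the g32 / g31 residuals ⟺ C ∧ D₄, and THE TREE ASIDE 28338 `NoWildContactFreeOffLocusTowers` ⟺ the g34 located
residual `NoWildOccultDivisorialOrNonThreefoldMixedTowers` (`noWildContactFreeOffLocusTowers_iff_g34 (h71) (h640)`).
 Imports `MaxContactCutFactorCut` (⊇ `MaxContactCutTauChainCut`, for the landed
`noWildLatentFactorNonThreefoldMixedTowers_of_h71`) + `RestrictCutCells`; 0 sorry.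

[WRITER NOTE (decomp-res writer g12): file split only (tree files ≤ 400 lines); namespace, sections, section
variables / universes / opens and every declaration exactly as in the lens (the node's file-level
dupNamespace-linter line is dropped — the library sets it; the `open …Theses` line lives only in the Theses-cone
file `MaxContactCutRestrictCut`); ONE dedup token change in `RestrictCutKernels`: the lens's 3-line folklore lemma
`stalkIdeal_bot_eq` restates the LANDED `TrackC.stalkIdeal_bot`
(`Theorems/WeightedInvariantLocalWeightedDropTrackCForward`, landed the same morning by another hand; pre-flight
`dedup.landed`) — the copy is DELETED, that module imported, and its one use in §107 cites `TrackC.stalkIdeal_bot`;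
ONE critic-sanctioned token change in this cone file: the lens's primed re-derivation
`noWildLatentFactorNonThreefoldMixedTowers_of_h71'` (3 lines, statement-identical to the LANDED
`MaxContactCutFactorCut.noWildLatentFactorNonThreefoldMixedTowers_of_h71`, hence a `dedup.landed` restatement) is
DELETED and the landed unprimed name is used in
`noWildMixedWallFreeFreshJumpShallowCompanionKangarooTowers_iff_g34_of_h71` — rider INBOX :1135 «optional:
`…_of_h71'` → unprimed name if MaxContactCutFactorCut.lean lands first» (it did, p814420).]

(Sources: Hironaka1964 Ch. III; Giraud1975; Kollar2007 3.58–3.60; CossartJannsenSaito2020 Thm. 6.40, Ch. 8;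
Hauser2010Kangaroo; HauserPerlega2019 §2; CossartPiltant2008 §2; deJong1996 (alterations); Hironaka2005 (numerical
exponent, three key theorems); EGAIV4 §16, §21 (divisors); Matsumura1987 §20 (UFD), §28; StacksProject 0804 / 0BIQ /
031I / 0AFT.)
-/

noncomputable section

open CategoryTheory AlgebraicGeometry IsLocalRing TopologicalSpace
open Literature.AlgebraicGeometry.Resolution
open Summit.ResolutionOfSingularities.ResolutionOfSingularities.Theses
open Summit.ResolutionOfSingularities.ResolutionOfSingularities.Theorems
open WeakOrderReduction ForcedTowerClasses DivergentTowerClasses MonomialTowerClasses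
open HugDimensionClasses HugDimensionKernels SurfaceShadowClasses SurfaceShadowKernels
open NearPointCut (SingularClass)
open Scheme.IdealSheafData (vanishingIdeal)
open scoped BigOperators

namespace Summit.ResolutionOfSingularities.ResolutionOfSingularities.Theorems.HugValuationCut

section NonDivisorialThesesCone

/-! ## ══ FILE 3/3 `Theorems/MaxContactCutRestrictCut.lean` (§110; Theses cone, imports FILE 2 +
`MaxContactCutTauChainCut`) ══ -/

/-! ## §110 (g34 · NEW) THE RE-LOCATIONS MODULO 31571 AND THE SURFACE PORT (Theses cone)

CELL B is decided modulo 31571 (`wildLatentFactorNonThreefoldMixed_of_contact`, g33), so MOD 31571 the g32 residual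
⟺ C ∧ D₄, and —
through g32's `noWildContactFreeOffLocusTowers_iff_g32 (h71) (h640)` family — the TREE ASIDE 28338, g23's `p`-power
residual and the
kangaroo residuals ⟺ C ∧ D₄ given 31571 and the surface port.  No port is added, none removed. -/

/-- **EXACT RE-LOCATION BY NAME MOD 31571: the g32 residual ⟺ C ∧ D₄.** [folklore] -/
theorem noWildMixedWallFreeFreshJumpShallowCompanionKangarooTowers_iff_g34_of_h71 (h71 : MaxContactCut.NoContactHuggingTowers) :
    NoWildMixedWallFreeFreshJumpShallowCompanionKangarooTowers ↔ NoWildOccultDivisorialOrNonThreefoldMixedTowers :=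
  noWildMixedWallFreeFreshJumpShallowCompanionKangarooTowers_iff_g34.trans
    ⟨fun h => h.2, fun h => ⟨noWildLatentFactorNonThreefoldMixedTowers_of_h71 h71, h⟩⟩

/-- **GIVEN THE PORT AND 31571: THE g31 residual ⟺ C ∧ D₄.** [folklore] -/
theorem noWildNonSurfaceWallFreeFreshJumpShallowCompanionKangarooTowers_iff_g34_of_h71 (h71 : MaxContactCut.NoContactHuggingTowers) :
    NoWildNonSurfaceWallFreeFreshJumpShallowCompanionKangarooTowers ↔ NoWildOccultDivisorialOrNonThreefoldMixedTowers :=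
  noWildNonSurfaceWallFreeFreshJumpShallowCompanionKangarooTowers_iff_g32.trans
    (noWildMixedWallFreeFreshJumpShallowCompanionKangarooTowers_iff_g34_of_h71 h71)

/-- **GIVEN 31571 AND THE PORT, THE TREE ASIDE 28338 ⟺ THE g34 LOCATED RESIDUAL** — `NoWildContactFreeOffLocusTowers` ⟺ (no wild
occult divisorial mixed tower) ∧ (no wild occult non-divisorial NON-THREEFOLD mixed tower). [folklore] -/
theorem noWildContactFreeOffLocusTowers_iff_g34 (h71 : MaxContactCut.NoContactHuggingTowers) (h640 : SurfaceChainPort) :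
    NoWildContactFreeOffLocusTowers ↔ NoWildOccultDivisorialOrNonThreefoldMixedTowers :=
  (noWildContactFreeOffLocusTowers_iff_g32 h71 h640).trans (noWildMixedWallFreeFreshJumpShallowCompanionKangarooTowers_iff_g34_of_h71 h71)

/-- **GIVEN 31571 AND THE PORT: g23's `p`-power residual ⟺ the g34 located residual.** [folklore] -/
theorem noWildPPowerOffLocusTowers_iff_g34 (h71 : MaxContactCut.NoContactHuggingTowers) (h640 : SurfaceChainPort) :
    NoWildPPowerOffLocusTowers ↔ NoWildOccultDivisorialOrNonThreefoldMixedTowers :=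
  (noWildPPowerOffLocusTowers_iff_g32 h71 h640).trans (noWildMixedWallFreeFreshJumpShallowCompanionKangarooTowers_iff_g34_of_h71 h71)

/-- **GIVEN 31571 AND THE PORT: the kangaroo residuals (g27, g25) ⟺ the g34 located residual.** [folklore] -/
theorem noWildKangarooOffLocusTowers_iff_g34 (h71 : MaxContactCut.NoContactHuggingTowers) (h640 : SurfaceChainPort) :
    NoWildKangarooOffLocusTowers ↔ NoWildOccultDivisorialOrNonThreefoldMixedTowers :=
  (noWildKangarooOffLocusTowers_iff_g32 h71 h640).trans (noWildMixedWallFreeFreshJumpShallowCompanionKangarooTowers_iff_g34_of_h71 h71)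

/-- `noWildKangarooOffDoublePointTowers_iff_g34`: Auxiliary step of this node's calculus, VERBATIM from the lens
file (see the module docstring); the statement is its type. [folklore] -/
theorem noWildKangarooOffDoublePointTowers_iff_g34 (h71 : MaxContactCut.NoContactHuggingTowers) (h640 : SurfaceChainPort) :
    NoWildKangarooOffDoublePointTowers ↔ NoWildOccultDivisorialOrNonThreefoldMixedTowers :=
  (noWildKangarooOffDoublePointTowers_iff_g32 h71 h640).trans
    (noWildMixedWallFreeFreshJumpShallowCompanionKangarooTowers_iff_g34_of_h71 h71)

end NonDivisorialThesesCone

end Summit.ResolutionOfSingularities.ResolutionOfSingularities.Theorems.HugValuationCut
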